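import Mathlib

/-!
# The TOP gate of the (j, j′) pair at the extreme ideal mass — the abstract PARTS inequality
(blind cell PercRepro2, night-2 g30; proofs/NIGHT2-DARC.md §72.10)

For `ent = {m}`, any `ent' ∋ j, j'`, entry markers `x = 1[j]`, `y = 1[j']` and the TOP gate
`d' = d·1[{m, j, j'} ⊆ W]`, the cleared (XA′) functional is `F_closed + ω·Φ` with `ω` the gate-open
mass `νd(↑{m, j, j'})` and `Φ = L·P̄x·P̄y + Q̃x·P̄y + Q̃y·P̄x` (`P̄` the `x`-unmarked resp. `y`-unmarked masses) — affine in the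
ideal mass `a` at fixed `a + δ` AND affine in `ω`.  At the extreme `a = J − XJ` (every killed
cluster `x`-marked) it is a 66-term integer certificate in the Holley facts `JU, JM, McM` of the
parts model and the two KILLED-VS-GATE facts `XJ·(YM − ω) ≤ (J − XJ)·ω`, `YJ·(XM − ω) ≤ (J − YJ)·ω`
(the killed `x`-marked clusters against the gate-killed `y`-marked ones: meet in the `ent`-free
`x`-unmarked clusters, join in the top cell) — `cg_top_core`.  The other extreme `a = 0` is the
open piece of the top gate (§72.10).
-/

namespace Summit.Ventures.PercRepro2.Coin

section TopGateAlg

variable {R : Type*} [Field R] [LinearOrder R] [IsStrictOrderedRing R]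

/-- **The top gate at the extreme `a = J − XJ`**: a 66-term integer certificate. -/
theorem cg_top_core (J u t XJ XU XM YJ YU YM w : R)
    (hJ : 0 ≤ J) (hu : 0 ≤ u) (ht : 0 ≤ t) (hXJ : 0 ≤ XJ) (hXU : 0 ≤ XU) (hXM : 0 ≤ XM)
    (hYJ : 0 ≤ YJ) (hYU : 0 ≤ YU) (hYM : 0 ≤ YM) (hw : 0 ≤ w)
    (hJUx : 0 ≤ XU * J - XJ * u) (hJMx : 0 ≤ XM * J - XJ * t)
    (hMcMx : 0 ≤ XM * (J + u) - (XJ + XU) * t) (hJUy : 0 ≤ YU * J - YJ * u)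
    (hIMx : 0 ≤ (J - XJ) * w - XJ * (YM - w)) (hIMy : 0 ≤ (J - YJ) * w - YJ * (XM - w))
    (hXJJ : 0 ≤ J - XJ) (hXUu : 0 ≤ u - XU) (hXMt : 0 ≤ t - XM) (hYJJ : 0 ≤ J - YJ)
    (hYUu : 0 ≤ u - YU) (hYMt : 0 ≤ t - YM) (hwXM : 0 ≤ XM - w) (hwYM : 0 ≤ YM - w) :
    0 ≤ (J - XJ) * (J + u + t) * (XJ + XU + XM) * (YJ + YU + YM)
        - (XJ * (J + u + t) - XJ * (XJ + XU + XM)) * (YM * (J + u + t) - t * (YJ + YU + YM))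
        - (YJ * (J + u + t) - XJ * (YJ + YU + YM)) * (XM * (J + u + t) - t * (XJ + XU + XM))
        + w * ((J + u + t) * ((J + u + t) - (XJ + XU + XM)) * ((J + u + t) - (YJ + YU + YM))
            + (XJ * (J + u + t) - XJ * (XJ + XU + XM)) * ((J + u + t) - (YJ + YU + YM))
            + (YJ * (J + u + t) - XJ * (YJ + YU + YM)) * ((J + u + t) - (XJ + XU + XM))) := by
  have H0 := (mul_nonneg hMcMx hJUy)
  have H1 := (mul_nonneg (mul_nonneg hJUx hu) hYM)
  have H2 := (mul_nonneg (mul_nonneg hJMx hu) hYM)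
  have H3 := (mul_nonneg (mul_nonneg hJMx hXJ) hYM)
  have H4 := (mul_nonneg (mul_nonneg hJMx hXU) hYM)
  have H5 := (mul_nonneg (mul_nonneg hIMx hJ) hu)
  have H6 := (mul_nonneg (mul_nonneg hIMy hXUu) ht)
  have H7 := (mul_nonneg (mul_nonneg (mul_nonneg hXJJ hXJJ) hJ) hw)
  have H8 := (mul_nonneg (mul_nonneg (mul_nonneg hXJJ hXJJ) hYU) hw)
  have H9 := (mul_nonneg (mul_nonneg (mul_nonneg hXJJ hXJJ) hYM) hw)
  have H10 := (mul_nonneg (mul_nonneg (mul_nonneg hXJJ hXUu) hu) hw)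
  have H11 := (mul_nonneg (mul_nonneg (mul_nonneg hXJJ hXMt) hXU) hYM)
  have H12 := (mul_nonneg (mul_nonneg (mul_nonneg hXJJ hXMt) hYM) hw)
  have H13 := (mul_nonneg (mul_nonneg (mul_nonneg hXJJ hYJJ) hXJ) hw)
  have H14 := (mul_nonneg (mul_nonneg (mul_nonneg hXJJ hYUu) hJ) hw)
  have H15 := (mul_nonneg (mul_nonneg (mul_nonneg hXJJ hYUu) hu) hw)
  have H16 := (mul_nonneg (mul_nonneg (mul_nonneg hXJJ hYUu) hXJ) hw)
  have H17 := (mul_nonneg (mul_nonneg (mul_nonneg hXJJ hYUu) hXM) hw)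
  have H18 := (mul_nonneg (mul_nonneg (mul_nonneg hXJJ hYMt) hJ) hw)
  have H19 := (mul_nonneg (mul_nonneg (mul_nonneg hXJJ hYMt) hXJ) hw)
  have H20 := (mul_nonneg (mul_nonneg (mul_nonneg hXJJ hYMt) hXU) hw)
  have H21 := (mul_nonneg (mul_nonneg (mul_nonneg hXJJ hYMt) hXM) hw)
  have H22 := (mul_nonneg (mul_nonneg (mul_nonneg hXJJ hwXM) hJ) hYM)
  have H23 := (mul_nonneg (mul_nonneg (mul_nonneg hXJJ hJ) ht) hw)
  have H24 := (mul_nonneg (mul_nonneg (mul_nonneg hXJJ hJ) hXJ) hYJ)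
  have H25 := (mul_nonneg (mul_nonneg (mul_nonneg hXJJ hJ) hXJ) hYU)
  have H26 := (mul_nonneg (mul_nonneg (mul_nonneg hXJJ hJ) hXU) hYJ)
  have H27 := (mul_nonneg (mul_nonneg (mul_nonneg hXJJ hJ) hXU) hYU)
  have H28 := (mul_nonneg (mul_nonneg (mul_nonneg hXJJ hu) hXJ) hYJ)
  have H29 := (mul_nonneg (mul_nonneg (mul_nonneg hXJJ hu) hXJ) hYU)
  have H30 := (mul_nonneg (mul_nonneg (mul_nonneg hXJJ hu) hXU) hYJ)
  have H31 := (mul_nonneg (mul_nonneg (mul_nonneg hXJJ hu) hXU) hYU)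
  have H32 := (mul_nonneg (mul_nonneg (mul_nonneg hXJJ ht) hXJ) hYJ)
  have H33 := (mul_nonneg (mul_nonneg (mul_nonneg hXJJ ht) hXJ) hYU)
  have H34 := (mul_nonneg (mul_nonneg (mul_nonneg hXJJ ht) hXU) hYJ)
  have H35 := (mul_nonneg (mul_nonneg (mul_nonneg hXJJ ht) hXU) hYU)
  have H36 := (mul_nonneg (mul_nonneg (mul_nonneg hXJJ ht) hXM) hYU)
  have H37 := (mul_nonneg (mul_nonneg (mul_nonneg hXJJ ht) hXM) hYM)
  have H38 := (mul_nonneg (mul_nonneg (mul_nonneg hXUu hYJJ) hXJ) hw)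
  have H39 := (mul_nonneg (mul_nonneg (mul_nonneg hXUu hYUu) hJ) hw)
  have H40 := (mul_nonneg (mul_nonneg (mul_nonneg hXUu hYUu) hu) hw)
  have H41 := (mul_nonneg (mul_nonneg (mul_nonneg hXUu hYUu) ht) hw)
  have H42 := (mul_nonneg (mul_nonneg (mul_nonneg hXUu hYUu) hXJ) hw)
  have H43 := (mul_nonneg (mul_nonneg (mul_nonneg hXUu hYMt) hJ) hw)
  have H44 := (mul_nonneg (mul_nonneg (mul_nonneg hXUu hYMt) hu) hw)
  have H45 := (mul_nonneg (mul_nonneg (mul_nonneg hXUu hYMt) ht) hw)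
  have H46 := (mul_nonneg (mul_nonneg (mul_nonneg hXUu hYMt) hXJ) hYJ)
  have H47 := (mul_nonneg (mul_nonneg (mul_nonneg hXUu hwXM) hXJ) hYM)
  have H48 := (mul_nonneg (mul_nonneg (mul_nonneg hXUu hwYM) hXJ) hYJ)
  have H49 := (mul_nonneg (mul_nonneg (mul_nonneg hXUu ht) hXJ) hYU)
  have H50 := (mul_nonneg (mul_nonneg (mul_nonneg hXMt hXMt) hXJ) hYJ)
  have H51 := (mul_nonneg (mul_nonneg (mul_nonneg hXMt hXMt) hXJ) hYU)
  have H52 := (mul_nonneg (mul_nonneg (mul_nonneg hXMt hYJJ) hXJ) hw)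
  have H53 := (mul_nonneg (mul_nonneg (mul_nonneg hXMt hYUu) hJ) hw)
  have H54 := (mul_nonneg (mul_nonneg (mul_nonneg hXMt hYUu) hu) hw)
  have H55 := (mul_nonneg (mul_nonneg (mul_nonneg hXMt hYUu) ht) hw)
  have H56 := (mul_nonneg (mul_nonneg (mul_nonneg hXMt hYMt) hJ) hw)
  have H57 := (mul_nonneg (mul_nonneg (mul_nonneg hXMt hYMt) hu) hw)
  have H58 := (mul_nonneg (mul_nonneg (mul_nonneg hXMt hYMt) ht) hw)
  have H59 := (mul_nonneg (mul_nonneg (mul_nonneg hXMt hwXM) hXJ) hYJ)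
  have H60 := (mul_nonneg (mul_nonneg (mul_nonneg hXMt hwXM) hXJ) hYU)
  have H61 := (mul_nonneg (mul_nonneg (mul_nonneg hXMt hJ) hJ) hw)
  have H62 := (mul_nonneg (mul_nonneg (mul_nonneg hXMt hJ) hu) hw)
  have H63 := (mul_nonneg (mul_nonneg (mul_nonneg hXMt ht) hXJ) hYJ)
  have H64 := (mul_nonneg (mul_nonneg (mul_nonneg hXMt ht) hXU) hYJ)
  have H65 := (mul_nonneg (mul_nonneg (mul_nonneg hwYM hJ) hJ) hXU)
  linear_combination H0 + H1 + H2 + 2 * H3 + H4 + H5 + H6 + H7 + H8 + H9 + H10 + H11 + H12 + 2 * H13 + 2 * H14 + H15 + H16 + H17 + H18 + H19 + H20 + H21 + H22 + H23 + H24 + H25 + H26 + H27 + H28 + H29 + H30 + H31 + 3 * H32 + 3 * H33 + 2 * H34 + 2 * H35 + H36 + H37 + H38 + H39 + H40 + H41 + 2 * H42 + 2 * H43 + H44 + H45 + H46 + H47 + H48 + H49 + H50 + H51 + H52 + 2 * H53 + H54 + H55 + 3 * H56 + H57 + H58 + H59 + H60 + H61 + H62 + H63 + H64 + H65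

end TopGateAlg

end Summit.Ventures.PercRepro2.Coin
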